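import Summits.CriticalPhenomena.PercolationContinuityZ3.Theorems.Transplant.PlanarDirConeSchedule
import Summits.CriticalPhenomena.PercolationContinuityZ3.Theorems.Transplant.WeightedConeConstants
import HarnessLib

/-!
# WEIGHTED CONES of `ℤ³` around a COORDINATE-PLANE direction — VII: constants and thresholds of the exit datum, the gap to the station
# (for `v = (v₀, v₁, 0)`; the constants are those of `WeightedConeConstants` with `k + 2` in place of `k`)

builds on p205010 (kernel theorem, internal audit signed; external expert review pending) — NOT used in this file.
Lane `prim-bschramm`, seat `prim-bschramm-p2` (gen 30; class C1b, METHOD = input substitution; memo `HOME/bschramm/P2-LATTICES.md` §107);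
helper file (`--supports stmt-CriticalPhenomena-4575 --as helper`) for ROW N6 of TABLE v44 (directions with exactly one vanishing coordinate).
With `k' = k + 2`: climb length `c = climbN κ K τ k'`, move cap `A_N = capN K τ k' N = ⌊τN/2K⌋ − k − 2` (so that BOTH caps `(A_N + k)K ≤ τN` and
`K(2A_N + 3) ≤ τN` of `PlanarDirConeSchedule.step₀` hold), station `R_N = stR v κ K τ k' N`, `J = movesJ v κ K` moves, threshold
`threshN v κ K τ k'`.  **`thresholds₀`** (real arithmetic, as `WCone.thresholds`); **`tgt_gap₀`** (a cone point of height in `(N, H₁]` lies below the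
station in the positive coordinates, with `⟨v,v⟩·gapⱼ ≤ vⱼ(c+1)K + τH₁S(vⱼ/κ + 1) + ⟨v,v⟩`, and `⟨v,v⟩|x₂| ≤ τH₁S` for the zero-weight coordinate).
[cite: AizenmanChayesChayesFrohlichRusso1983, §4 Cor. to Lemma 4.3] [cite: GrimmettPercolation1999, §7.2 p. 148] -/

noncomputable section

namespace Summit.CriticalPhenomena.PercolationContinuityZ3.Theorems.Transplant

namespace PWCone

open MeasureTheory Literature.Probability.Percolation Literature.Probability.LatticeModels SimpleGraph HSU OrthantUniq HalfSlabUniq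
  TubeSlabUniq DesignTransport WallUniq DiagCone SectorSlab ConeSlabUniq WCone Filter
open scoped Classical

section Cone

variable {v : Fin 3 → ℝ} {κ K τ h : ℝ} (hv2 : v 2 = 0) (hκ : 0 < κ) (hv0 : κ ≤ v 0) (hv1 : κ ≤ v 1) (hvK : ∀ i, v i ≤ K) (hτ : 0 < τ)
  (hh : K ≤ τ * h) {D : Set (Site 3)} (hCD : ∀ x : Site 3, x ∈ D ↔ h ≤ hgt v x ∧ ∀ i j : Fin 3, dev v x i j ≤ τ * hgt v x)
  {k : ℕ}

/-! ## §1 Positivity and the thresholds -/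

include hv2 hκ hv0 hv1 hvK hτ in
/-- Positivity of the constants for `v = (v₀, v₁, 0)`: `S = v₀ + v₁ > 0`, `⟨v,v⟩ > 0`, `G ≥ 0`, `E₀ ≥ 3`, `K > 0`. [folklore] -/
theorem consts_pos₀ : 0 < sumv v ∧ 0 < nsq v ∧ 0 ≤ Gconst v κ ∧ 3 ≤ E0 v κ K τ k ∧ 0 < K := by
  obtain ⟨hvn, -, h0, h1⟩ := v_facts hv2 hκ hv0 hv1
  have hK : 0 < K := h0.trans_le (hvK 0)
  have hS : 0 < sumv v := by unfold sumv; rw [hv2]; linarith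
  have hV : 0 < nsq v := by unfold nsq; rw [hv2]; nlinarith
  have hG : 0 ≤ Gconst v κ := by unfold Gconst; positivity
  refine ⟨hS, hV, hG, ?_, hK⟩
  unfold E0
  have : 0 ≤ ((climbN κ K τ k : ℝ) + 1) * K * sumv v / nsq v := by positivity
  have : 0 ≤ τ * Gconst v κ * (((climbN κ K τ k : ℝ) + 1) * K) := by positivity
  linarith

include hv2 hκ hv0 hv1 hvK hτ in
/-- **The thresholds** (with `k' = k + 2`): for `N ≥ threshN v κ K τ k'`, `A_N = capN K τ k' N` satisfies `A_N ≥ 1`, `(A_N + k + 2)K ≤ τN/2` (hence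
both caps of `step₀`), and `E₀ + τGN + 3A_N < (J+1)A_N`. [folklore] -/
theorem thresholds₀ {N : ℕ} (hN : threshN v κ K τ (k + 2) ≤ N) :
    1 ≤ capN K τ (k + 2) N ∧ (((capN K τ (k + 2) N : ℝ) + (k + 2)) * K ≤ τ * N / 2) ∧
      (E0 v κ K τ (k + 2) + τ * Gconst v κ * N + 3 * capN K τ (k + 2) N < ((movesJ v κ K : ℝ) + 1) * capN K τ (k + 2) N) := by
  obtain ⟨hS, hV, hG, hE3, hK⟩ := consts_pos₀ (τ := τ) (k := k + 2) hv2 hκ hv0 hv1 hvK hτ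
  have hN0 : (0 : ℝ) ≤ N := by positivity
  set x : ℝ := τ * (N : ℝ) / (2 * K) with hxdef
  have hx : 2 * K * x = τ * N := by rw [hxdef]; field_simp
  have hx0 : 0 ≤ x := by positivity
  set J₂ : ℝ := (⌈4 * K * Gconst v κ⌉₊ : ℝ) + 1 with hJ₂
  have hJ₂ge : 4 * K * Gconst v κ + 1 ≤ J₂ := by have := Nat.le_ceil (4 * K * Gconst v κ); rw [hJ₂]; linarith
  have hc0 : (0 : ℝ) ≤ ⌈4 * K * Gconst v κ⌉₊ := by positivity
  have hJ₂1 : 1 ≤ J₂ := by rw [hJ₂]; linarith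
  have hk0 : (0 : ℝ) ≤ k := by positivity
  set k' : ℕ := k + 2 with hk'
  have hk'r : ((k' : ℕ) : ℝ) = (k : ℝ) + 2 := by rw [hk']; push_cast; ring
  have hthr : E0 v κ K τ k' + J₂ * ((k' : ℝ) + 1) < x := by
    have h1 : 2 * K * (E0 v κ K τ k' + J₂ * ((k' : ℝ) + 1)) / τ + 1 ≤ N := hN
    have h3 : (2 * K * (E0 v κ K τ k' + J₂ * ((k' : ℝ) + 1)) / τ + 1) * τ ≤ (N : ℝ) * τ := mul_le_mul_of_nonneg_right h1 hτ.le
    have h2 : 2 * K * (E0 v κ K τ k' + J₂ * ((k' : ℝ) + 1)) / τ * τ = 2 * K * (E0 v κ K τ k' + J₂ * ((k' : ℝ) + 1)) :=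
      div_mul_cancel₀ _ hτ.ne'
    have h4 : 2 * K * (E0 v κ K τ k' + J₂ * ((k' : ℝ) + 1)) + τ ≤ 2 * K * x := by rw [hx]; nlinarith
    nlinarith
  have hxk : (k' : ℝ) + 2 ≤ x := by nlinarith
  have hfl : (⌊x⌋₊ : ℝ) ≤ x := Nat.floor_le hx0
  have hfl' : x < (⌊x⌋₊ : ℝ) + 1 := Nat.lt_floor_add_one x
  have hflk : k' + 1 ≤ ⌊x⌋₊ := by
    have : (k' : ℝ) < ⌊x⌋₊ := by linarith
    exact_mod_cast this
  have hcap_def : capN K τ k' N = ⌊x⌋₊ - k' := rfl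
  have hA1 : 1 ≤ capN K τ k' N := by rw [hcap_def]; omega
  have hAk : ((capN K τ k' N : ℝ) + k') = ⌊x⌋₊ := by
    have : capN K τ k' N + k' = ⌊x⌋₊ := by rw [hcap_def]; omega
    exact_mod_cast this
  have hAx : (capN K τ k' N : ℝ) + k' ≤ x := by rw [hAk]; exact hfl
  have hAlo : x - k' - 1 ≤ capN K τ k' N := by linarith
  refine ⟨hA1, ?_, ?_⟩
  · rw [← hk'r]
    have : ((capN K τ k' N : ℝ) + k') * K ≤ x * K := mul_le_mul_of_nonneg_right hAx hK.le
    have e : τ * (N : ℝ) / 2 = x * K := by rw [← hx]; ring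
    rw [e]; exact this
  · have hJ : (movesJ v κ K : ℝ) + 1 = J₂ + 3 := by simp only [movesJ, hJ₂]; push_cast; ring
    rw [hJ]
    have hGN : 0 ≤ τ * Gconst v κ * N := by positivity
    have h1 : J₂ * (x - k' - 1) ≤ J₂ * capN K τ k' N := mul_le_mul_of_nonneg_left hAlo (by linarith)
    have h2 : (4 * K * Gconst v κ + 1) * x ≤ J₂ * x := mul_le_mul_of_nonneg_right hJ₂ge hx0
    have h3 : 4 * K * Gconst v κ * x = 2 * (τ * Gconst v κ * N) := by
      calc 4 * K * Gconst v κ * x = 2 * Gconst v κ * (2 * K * x) := by ring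
        _ = 2 * (τ * Gconst v κ * N) := by rw [hx]; ring
    nlinarith

/-! ## §2 The gap to the station -/

include hv2 hκ hv0 hv1 hvK hτ hCD in
/-- **The gap to the station** (positive coordinates).  If `P ∈ 𝕂` with `N < H(P) ≤ H₁ = topH κ K τ k' N` then, with `R = stR v κ K τ k' N`, for
`j ≠ 2`: `Pⱼ ≤ ⌈Rvⱼ⌉` and `⟨v,v⟩(⌈Rvⱼ⌉ − Pⱼ) ≤ vⱼ(c+1)K + τH₁S(vⱼ/κ + 1) + ⟨v,v⟩`; and `⟨v,v⟩|P₂| ≤ τH₁S`. [folklore] -/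
theorem tgt_gap₀ {k' N : ℕ} {P : Site 3} (hP : P ∈ D) (hlo : (N : ℝ) < hgt v P) (hhi : hgt v P ≤ topH κ K τ k' N) :
    (∀ j : Fin 3, j ≠ 2 → P j ≤ tgt v (stR v κ K τ k' N) j ∧
      nsq v * ((tgt v (stR v κ K τ k' N) j : ℝ) - P j) ≤
        v j * (((climbN κ K τ k' : ℝ) + 1) * K) + τ * topH κ K τ k' N * sumv v * (v j / κ + 1) + nsq v) ∧
      nsq v * |(P 2 : ℝ)| ≤ τ * topH κ K τ k' N * sumv v := by
  obtain ⟨hS, hV, -, -, hK⟩ := consts_pos₀ (τ := τ) (k := k') hv2 hκ hv0 hv1 hvK hτ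
  obtain ⟨hvn, hκi, -, -⟩ := v_facts hv2 hκ hv0 hv1
  have hN0 : (0 : ℝ) ≤ N := by positivity
  have hH1 : 0 ≤ topH κ K τ k' N := by unfold topH; positivity
  have s2 : τ * sumv v * hgt v P ≤ τ * sumv v * topH κ K τ k' N := mul_le_mul_of_nonneg_left hhi (mul_pos hτ hS).le
  refine ⟨fun j hj => ?_, ?_⟩
  · have hvj : 0 < v j := hκ.trans_le (hκi j hj); have hκj := hκi j hj
    obtain ⟨c1, c2⟩ := abs_le.1 (coord_bounds₀ hv2 hκ hv0 hv1 hCD hP j)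
    have hH1N : v j * topH κ K τ k' N - v j * N = v j * (((climbN κ K τ k' : ℝ) + 1) * K) := by unfold topH; ring
    have hRV : stR v κ K τ k' N * v j * nsq v = topH κ K τ k' N * v j + τ * topH κ K τ k' N * sumv v * (v j / κ) := by
      unfold stR; field_simp
    have hjκ : 1 ≤ v j / κ := by rw [le_div_iff₀ hκ, one_mul]; exact hκj
    have s1 : v j * hgt v P ≤ v j * topH κ K τ k' N := mul_le_mul_of_nonneg_left hhi hvj.le
    have s3 : τ * topH κ K τ k' N * sumv v ≤ τ * topH κ K τ k' N * sumv v * (v j / κ) :=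
      le_mul_of_one_le_right (by positivity) hjκ
    have s4 : v j * (N : ℝ) ≤ v j * hgt v P := mul_le_mul_of_nonneg_left hlo.le hvj.le
    unfold nsq at hV hRV ⊢
    unfold sumv at s2 s3 hRV ⊢
    have hup : (v 0 * v 0 + v 1 * v 1 + v 2 * v 2) * (P j : ℝ) ≤
        (v 0 * v 0 + v 1 * v 1 + v 2 * v 2) * (stR v κ K τ k' N * v j) := by linarith
    have hle : (P j : ℝ) ≤ stR v κ K τ k' N * v j := le_of_mul_le_mul_left hup hV
    have hceil : stR v κ K τ k' N * v j ≤ ((tgt v (stR v κ K τ k' N) j : ℤ) : ℝ) ∧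
        ((tgt v (stR v κ K τ k' N) j : ℤ) : ℝ) < stR v κ K τ k' N * v j + 1 :=
      ⟨by rw [tgt_apply]; exact Int.le_ceil _, by rw [tgt_apply]; exact Int.ceil_lt_add_one _⟩
    refine ⟨by exact_mod_cast hle.trans hceil.1, ?_⟩
    have e1 : (v 0 * v 0 + v 1 * v 1 + v 2 * v 2) * ((tgt v (stR v κ K τ k' N) j : ℤ) : ℝ) ≤
        (v 0 * v 0 + v 1 * v 1 + v 2 * v 2) * (stR v κ K τ k' N * v j + 1) := mul_le_mul_of_nonneg_left hceil.2.le hV.le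
    linarith
  · obtain ⟨c1, c2⟩ := abs_le.1 (coord_bounds₀ hv2 hκ hv0 hv1 hCD hP 2)
    unfold nsq; unfold sumv at s2 ⊢
    have hV' : 0 ≤ v 0 * v 0 + v 1 * v 1 + v 2 * v 2 := by unfold nsq at hV; exact hV.le
    rw [← abs_of_nonneg hV', ← abs_mul, abs_le]
    simp only [hv2, mul_zero, zero_mul, add_zero, sub_zero] at c1 c2 s2 ⊢
    constructor <;> linarith

end Cone

end PWCone

end Summit.CriticalPhenomena.PercolationContinuityZ3.Theorems.Transplant

end
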